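import Mathlib
import Literature.NumberTheory.Transcendental.KZCalculusProofs
import Literature.NumberTheory.Transcendental.SemialgebraicMapsProofs
import Literature.NumberTheory.Transcendental.KZSemialgebraicComplex
import Literature.NumberTheory.Transcendental.KZLogCalculusProofs
import Literature.NumberTheory.Transcendental.KZDominatedFamilyRelations
import Literature.NumberTheory.Transcendental.KZIdealTetrahedron
import Summits.KontsevichZagierPeriods.KontsevichZagierPeriods.Theorems.HyperbolicBlochOffTetraSectorKernelStubShadowSquareAux
import HarnessLib

/-!
# `OffTetraSectorKernel`, line `deform-to-the-oracle`: the shadow square (stub `stub_shadowSquare`)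

Stub `stub_shadowSquare` of the crux `OffTetraSectorKernel` (stmt-KontsevichZagierPeriods-10557, route
HyperbolicBloch): **the flat shadow of the ideal tetrahedron `T(i)` is KZ-equivalent to the shadow square**
`[[0,1)×(0,1), 1/(2 − a(1+s²))]` (both `= G`, Catalan's constant), and a shadow-square representation EXISTS.
The chain of moves (Kontsevich–Zagier 2001, §1.2):

1. rule (2), the fan map `Λ(a,s) = (a(1+s)/2, a(1−s)/2)` (`|det DΛ| = a/2`) from the rectangle
   `R = (0,1)×(−1,1)` onto the triangle `Δ(0,1,i)`: `[R, h] − [Δ, flat density] ∈ changeOfVariablesRel`,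
   `h(a,s) = 1/(2(2 − a(1+s²)))` (the rectangle representation `Q` is BUILT from the given flat shadow by
   Mathlib's change-of-variables integrability criterion);
2. rule (1a): the rectangle minus the null line `s = 0` is the disjoint union of its lower and upper halves;
3. rule (2), the reflection `(a,s) ↦ (a,−s)`: lower half `∼` upper half (`h` is even in `s`);
4. rule (1b): on the open unit square `1/(2 − a(1+s²)) = h + h`, so `[square, 1/(2 − a(1+s²))] ≡ 2·[upper half, h]`;
5. rule (1a), null edge `a = 0`: `[[0,1)×(0,1), f] ≡ [(0,1)², f]`.

Algebra (`…StubShadowSquareAux.lean`): `fan_image`, `fan_injOn`, `fan_isSemialgebraicMapOn`, `fan_moveData`,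
`reflect_data`, `reflect_image`, semialgebraic pieces. References: J. Milnor, *Hyperbolic geometry: the first
150 years* (1982), Appendix; M. Kontsevich, D. Zagier, *Periods* (2001), §1.2.
-/

noncomputable section

open Set MeasureTheory MvPolynomial
open Literature.NumberTheory.Transcendental Literature.ModelTheory.ExponentialFields

namespace Summit.KontsevichZagierPeriods.HyperbolicBloch.OffTetraSectorKernel

/-! ## Step 1: the rectangle representation, built from the flat shadow by the fan map -/

/-- **The rectangle representation and the fan move.** Given a flat-shadow representation `F` of `T(i)`
(triangle `{q₀>0, q₁>0, q₀+q₁<1}`, density `1/(2(q₀+q₁−q₀²−q₁²))`), there is a representation `Q` on the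
rectangle `(0,1)×(−1,1)` with integrand LITERALLY `h(a,s) = 1/(2(2 − a(1+s²)))` and `[Q] − [F] ∈ relations`
(one change of variables along the fan map). [cite: KontsevichZagier2001, §1.2 rule (2)] -/
theorem shadowSq_exists_rect (F : KZ.IntegralRep 2)
    (hF : F.domain = {q : Fin 2 → ℝ | 0 < q 0 ∧ 0 < q 1 ∧ q 0 + q 1 < 1})
    (hFi : EqOn F.integrand (fun q => 1 / (2 * (q 0 - q 0 ^ 2 - q 1 ^ 2 + q 1))) F.domain) :
    ∃ Q : KZ.IntegralRep 2, Q.domain = {x : Fin 2 → ℝ | 0 < x 0 ∧ x 0 < 1 ∧ -1 < x 1 ∧ x 1 < 1} ∧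
      Q.integrand = (fun x => 1 / (2 * (2 - x 0 * (1 + x 1 ^ 2)))) ∧ KZ.of Q - KZ.of F ∈ KZ.relations := by
  set Λ : (Fin 2 → ℝ) → (Fin 2 → ℝ) := fun v => ![v 0 * (1 + v 1) / 2, v 0 * (1 - v 1) / 2] with hΛdef
  have hΛ : ∀ v, Λ v = ![v 0 * (1 + v 1) / 2, v 0 * (1 - v 1) / 2] := fun _ => rfl
  set R : Set (Fin 2 → ℝ) := {x | 0 < x 0 ∧ x 0 < 1 ∧ -1 < x 1 ∧ x 1 < 1} with hRdef
  have hRsa : IsSemialgebraic ℚ R := shadowSq_isSemialgebraic_rect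
  have hRmeas : MeasurableSet R := IsSemialgebraic.measurableSet_holds hRsa
  have himage : Λ '' R = F.domain := by rw [hF]; exact fan_image Λ hΛ
  have hinj : InjOn Λ R := fan_injOn Λ hΛ
  obtain ⟨Λ', hΛ'⟩ := fan_moveData Λ hΛ
  have hderiv : ∀ x ∈ R, HasFDerivWithinAt Λ (Λ' x) R x := fun x _ => (hΛ' x).1.hasFDerivWithinAt
  have hRsub : ∀ x ∈ R, 0 ≤ x 0 ∧ x 0 < 1 ∧ -1 < x 1 ∧ x 1 < 1 := fun x hx =>
    ⟨hx.1.le, hx.2.1, hx.2.2.1, hx.2.2.2⟩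
  -- the Jacobian identity on `R`
  have hjac : ∀ x ∈ R, 1 / (2 * (2 - x 0 * (1 + x 1 ^ 2))) = F.integrand (Λ x) * |(Λ' x).det| := by
    intro x hx
    have hxF : Λ x ∈ F.domain := by rw [← himage]; exact mem_image_of_mem Λ hx
    rw [hFi hxF]
    exact (hΛ' x).2.2 hx.1 (shadowSq_den_pos hx.1.le hx.2.1 hx.2.2.1 hx.2.2.2)
  -- integrability of `h` on `R`, pulled back from `F`
  have hint : IntegrableOn (fun x : Fin 2 → ℝ => 1 / (2 * (2 - x 0 * (1 + x 1 ^ 2)))) R := by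
    have hFint : IntegrableOn F.integrand (Λ '' R) := by rw [himage]; exact F.integrableOn
    rw [integrableOn_image_iff_integrableOn_abs_det_fderiv_smul volume hRmeas hderiv hinj] at hFint
    refine hFint.congr_fun (fun x hx => ?_) hRmeas
    show |(Λ' x).det| • F.integrand (Λ x) = _
    rw [hjac x hx, smul_eq_mul, mul_comm]
  refine ⟨⟨R, fun x => 1 / (2 * (2 - x 0 * (1 + x 1 ^ 2))), hRsa,
    shadowSq_isSemialgebraicFunOn_halfDensity hRsa hRsub, hint⟩, rfl, rfl, ?_⟩
  exact KZ.changeOfVariablesRel_subset_relations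
    ⟨2, _, F, Λ, Λ', fan_isSemialgebraicMapOn Λ hΛ hRsa, hderiv, hinj, himage.symm,
      fun x hx => hjac x hx, rfl⟩

/-! ## Steps 2–3: halves of the rectangle -/

/-- **Splitting the rectangle.** For a rectangle representation `Q` with integrand `h`: the restrictions
`Q₋`, `Q₊` to the open lower and upper halves exist (as restrictions) and
`[Q] ≡ [Q₋] + [Q₊]` modulo `relations` (the line `s = 0` is null, then domain additivity).
[cite: KontsevichZagier2001, §1.2 rule (1)] -/
theorem shadowSq_split (Q : KZ.IntegralRep 2)
    (hQ : Q.domain = {x : Fin 2 → ℝ | 0 < x 0 ∧ x 0 < 1 ∧ -1 < x 1 ∧ x 1 < 1}) :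
    ∃ (hlo : {x : Fin 2 → ℝ | 0 < x 0 ∧ x 0 < 1 ∧ -1 < x 1 ∧ x 1 < 0} ⊆ Q.domain)
      (hup : {x : Fin 2 → ℝ | 0 < x 0 ∧ x 0 < 1 ∧ 0 < x 1 ∧ x 1 < 1} ⊆ Q.domain),
      KZ.of Q - KZ.of (Q.restrict _ shadowSq_isSemialgebraic_lower hlo) -
        KZ.of (Q.restrict _ shadowSq_isSemialgebraic_sq hup) ∈ KZ.relations := by
  have hlo : {x : Fin 2 → ℝ | 0 < x 0 ∧ x 0 < 1 ∧ -1 < x 1 ∧ x 1 < 0} ⊆ Q.domain := by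
    rw [hQ]; rintro x ⟨h0, h1, h2, h3⟩; exact ⟨h0, h1, h2, by linarith⟩
  have hup : {x : Fin 2 → ℝ | 0 < x 0 ∧ x 0 < 1 ∧ 0 < x 1 ∧ x 1 < 1} ⊆ Q.domain := by
    rw [hQ]; rintro x ⟨h0, h1, h2, h3⟩; exact ⟨h0, h1, by linarith, h3⟩
  refine ⟨hlo, hup, ?_⟩
  -- drop the null line `s = 0`
  set E : Set (Fin 2 → ℝ) := {x : Fin 2 → ℝ | 0 < x 0 ∧ x 0 < 1 ∧ -1 < x 1 ∧ x 1 < 0} ∪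
    {x : Fin 2 → ℝ | 0 < x 0 ∧ x 0 < 1 ∧ 0 < x 1 ∧ x 1 < 1} with hE
  have hEsa : IsSemialgebraic ℚ E := shadowSq_isSemialgebraic_lower.union shadowSq_isSemialgebraic_sq
  have hEQ : E ⊆ Q.domain := union_subset hlo hup
  have hnull : volume (Q.domain \ E) = 0 := by
    have hline : volume {x : Fin 2 → ℝ | x 1 = 0} = 0 := by
      rw [volume_pi]; exact Measure.pi_hyperplane _ 1 0
    refine measure_mono_null (fun x hx => ?_) hline
    rw [hQ] at hx
    obtain ⟨⟨h0, h1, h2, h3⟩, hxE⟩ := hx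
    by_contra hne
    rcases lt_or_gt_of_ne hne with hlt | hgt
    · exact hxE (Or.inl ⟨h0, h1, h2, hlt⟩)
    · exact hxE (Or.inr ⟨h0, h1, hgt, h3⟩)
  have h1 : KZ.of Q - KZ.of (Q.restrict E hEsa hEQ) ∈ KZ.relations :=
    Q.of_sub_of_restrict_mem_relations hEsa hEQ hnull
  -- domain additivity on `E = lower ∪ upper`
  have h2 : KZ.of (Q.restrict E hEsa hEQ) - KZ.of (Q.restrict _ shadowSq_isSemialgebraic_lower hlo) -
      KZ.of (Q.restrict _ shadowSq_isSemialgebraic_sq hup) ∈ KZ.relations := by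
    refine KZ.domainAddRel_subset_relations ⟨2, Q.restrict E hEsa hEQ,
      Q.restrict _ shadowSq_isSemialgebraic_lower hlo, Q.restrict _ shadowSq_isSemialgebraic_sq hup,
      rfl, ?_, fun _ _ => rfl, fun _ _ => rfl, rfl⟩
    have hdisj : (Q.restrict _ shadowSq_isSemialgebraic_lower hlo).domain ∩
        (Q.restrict _ shadowSq_isSemialgebraic_sq hup).domain = ∅ := by
      ext x
      simp only [KZ.IntegralRep.domain_restrict, mem_inter_iff, mem_setOf_eq, mem_empty_iff_false,
        iff_false]
      rintro ⟨⟨-, -, -, h3⟩, -, -, h2', -⟩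
      linarith
    rw [hdisj, measure_empty]
  have : KZ.of Q - KZ.of (Q.restrict _ shadowSq_isSemialgebraic_lower hlo) -
      KZ.of (Q.restrict _ shadowSq_isSemialgebraic_sq hup) =
      (KZ.of Q - KZ.of (Q.restrict E hEsa hEQ)) + (KZ.of (Q.restrict E hEsa hEQ) -
        KZ.of (Q.restrict _ shadowSq_isSemialgebraic_lower hlo) -
        KZ.of (Q.restrict _ shadowSq_isSemialgebraic_sq hup)) := by abel
  rw [this]
  exact add_mem h1 h2

/-- **The reflection move.** For a rectangle representation `Q` with the even integrand `h`, the lower-half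
restriction is KZ-equivalent to the upper-half restriction by the reflection `(a,s) ↦ (a,−s)` (rule 2,
`|det| = 1`). [cite: KontsevichZagier2001, §1.2 rule (2)] -/
theorem shadowSq_reflect (Q : KZ.IntegralRep 2)
    (hQi : Q.integrand = fun x => 1 / (2 * (2 - x 0 * (1 + x 1 ^ 2))))
    (hlo : {x : Fin 2 → ℝ | 0 < x 0 ∧ x 0 < 1 ∧ -1 < x 1 ∧ x 1 < 0} ⊆ Q.domain)
    (hup : {x : Fin 2 → ℝ | 0 < x 0 ∧ x 0 < 1 ∧ 0 < x 1 ∧ x 1 < 1} ⊆ Q.domain) :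
    KZ.of (Q.restrict _ shadowSq_isSemialgebraic_lower hlo) -
      KZ.of (Q.restrict _ shadowSq_isSemialgebraic_sq hup) ∈ KZ.relations := by
  obtain ⟨Rf, hRf, hdet, hderiv⟩ := reflect_data
  refine KZ.changeOfVariablesRel_subset_relations
    ⟨2, _, _, fun x => ![x 0, -(x 1)], fun _ => Rf,
      reflect_isSemialgebraicMapOn shadowSq_isSemialgebraic_lower,
      fun x _ => (hderiv x).hasFDerivWithinAt, reflect_injective.injOn, ?_, fun x _ => ?_, rfl⟩
  · simp only [KZ.IntegralRep.domain_restrict]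
    exact reflect_image.symm
  · simp only [KZ.IntegralRep.integrand_restrict, hQi, hdet, abs_neg, abs_one, mul_one,
      Matrix.cons_val_zero, Matrix.cons_val_one, Matrix.cons_val_fin_one, neg_sq]

/-! ## Steps 4–5: doubling and the null edge -/

/-- **Doubling** (rule 1b): a representation on the open unit square whose integrand is `1/(2 − a(1+s²))`
there equals, modulo `relations`, twice the upper-half restriction of a rectangle representation with
integrand `h = 1/(2(2 − a(1+s²)))`. [cite: KontsevichZagier2001, §1.2 rule (1)] -/
theorem shadowSq_double (Q : KZ.IntegralRep 2)
    (hQi : Q.integrand = fun x => 1 / (2 * (2 - x 0 * (1 + x 1 ^ 2))))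
    (hup : {x : Fin 2 → ℝ | 0 < x 0 ∧ x 0 < 1 ∧ 0 < x 1 ∧ x 1 < 1} ⊆ Q.domain)
    (T₀ : KZ.IntegralRep 2) (hT₀ : T₀.domain = {x : Fin 2 → ℝ | 0 < x 0 ∧ x 0 < 1 ∧ 0 < x 1 ∧ x 1 < 1})
    (hT₀i : EqOn T₀.integrand (fun x => 1 / (2 - x 0 * (1 + x 1 ^ 2))) T₀.domain) :
    KZ.of T₀ - KZ.of (Q.restrict _ shadowSq_isSemialgebraic_sq hup) -
      KZ.of (Q.restrict _ shadowSq_isSemialgebraic_sq hup) ∈ KZ.relations := by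
  refine KZ.integrandAddRel_subset_relations ⟨2, T₀, _, _, hT₀.symm, hT₀.symm, fun x hx => ?_, rfl⟩
  rw [hT₀i hx]
  simp only [Pi.add_apply, KZ.IntegralRep.integrand_restrict, hQi]
  rw [hT₀] at hx
  have hden := shadowSq_den_pos hx.1.le hx.2.1 (by linarith [hx.2.2.1]) hx.2.2.2
  field_simp
  ring

/-- **A shadow-square representation exists** on the half-closed square `[0,1)×(0,1)` with integrand
`1/(2 − a(1+s²))`: semialgebraic domain and integrand, integrable because the open square carries
`2h` with `h` integrable (restriction of a rectangle representation) and the edge `a = 0` is null.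
[cite: KontsevichZagier2001, §1.1] -/
theorem shadowSq_exists_T (Q : KZ.IntegralRep 2)
    (hQ : Q.domain = {x : Fin 2 → ℝ | 0 < x 0 ∧ x 0 < 1 ∧ -1 < x 1 ∧ x 1 < 1})
    (hQi : Q.integrand = fun x => 1 / (2 * (2 - x 0 * (1 + x 1 ^ 2)))) :
    ∃ T : KZ.IntegralRep 2, T.domain = {x : Fin 2 → ℝ | 0 ≤ x 0 ∧ x 0 < 1 ∧ 0 < x 1 ∧ x 1 < 1} ∧
      EqOn T.integrand (fun x => 1 / (2 - x 0 * (1 + x 1 ^ 2))) T.domain := by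
  have hsub : ∀ x ∈ {x : Fin 2 → ℝ | 0 ≤ x 0 ∧ x 0 < 1 ∧ 0 < x 1 ∧ x 1 < 1},
      0 ≤ x 0 ∧ x 0 < 1 ∧ -1 < x 1 ∧ x 1 < 1 := fun x hx =>
    ⟨hx.1, hx.2.1, by linarith [hx.2.2.1], hx.2.2.2⟩
  -- integrability on the open square: `f = 2 • h`
  have hup : {x : Fin 2 → ℝ | 0 < x 0 ∧ x 0 < 1 ∧ 0 < x 1 ∧ x 1 < 1} ⊆ Q.domain := by
    rw [hQ]; rintro x ⟨h0, h1, h2, h3⟩; exact ⟨h0, h1, by linarith, h3⟩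
  have hsqmeas : MeasurableSet {x : Fin 2 → ℝ | 0 < x 0 ∧ x 0 < 1 ∧ 0 < x 1 ∧ x 1 < 1} :=
    IsSemialgebraic.measurableSet_holds shadowSq_isSemialgebraic_sq
  have hsq : IntegrableOn (fun x : Fin 2 → ℝ => 1 / (2 - x 0 * (1 + x 1 ^ 2)))
      {x : Fin 2 → ℝ | 0 < x 0 ∧ x 0 < 1 ∧ 0 < x 1 ∧ x 1 < 1} := by
    have h : IntegrableOn (fun x => 2 * Q.integrand x)
        {x : Fin 2 → ℝ | 0 < x 0 ∧ x 0 < 1 ∧ 0 < x 1 ∧ x 1 < 1} := (Q.integrableOn.mono_set hup).const_mul 2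
    refine h.congr_fun (fun x hx => ?_) hsqmeas
    rw [hQi]
    have hden := shadowSq_den_pos hx.1.le hx.2.1 (by linarith [hx.2.2.1]) hx.2.2.2
    field_simp
  -- the null edge `a = 0`
  have hedge : IntegrableOn (fun x : Fin 2 → ℝ => 1 / (2 - x 0 * (1 + x 1 ^ 2)))
      {x : Fin 2 → ℝ | x 0 = 0} := by
    have hline : volume {x : Fin 2 → ℝ | x 0 = 0} = 0 := by
      rw [volume_pi]; exact Measure.pi_hyperplane _ 0 0
    rw [IntegrableOn, Measure.restrict_eq_zero.2 hline]
    exact integrable_zero_measure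
  have hint : IntegrableOn (fun x : Fin 2 → ℝ => 1 / (2 - x 0 * (1 + x 1 ^ 2)))
      {x : Fin 2 → ℝ | 0 ≤ x 0 ∧ x 0 < 1 ∧ 0 < x 1 ∧ x 1 < 1} := by
    refine (hsq.union hedge).mono_set fun x hx => ?_
    rcases hx.1.lt_or_eq with h | h
    · exact Or.inl ⟨h, hx.2.1, hx.2.2.1, hx.2.2.2⟩
    · exact Or.inr h.symm
  exact ⟨⟨_, fun x => 1 / (2 - x 0 * (1 + x 1 ^ 2)), shadowSq_isSemialgebraic_halfClosed,
    shadowSq_isSemialgebraicFunOn_density shadowSq_isSemialgebraic_halfClosed hsub, hint⟩,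
    rfl, fun _ _ => rfl⟩

/-- **The null edge `a = 0`** (rule 1a): a representation on `[0,1)×(0,1)` is KZ-equivalent to its restriction to
the open square. [cite: KontsevichZagier2001, §1.2 rule (1)] -/
theorem shadowSq_edge (T : KZ.IntegralRep 2)
    (hT : T.domain = {x : Fin 2 → ℝ | 0 ≤ x 0 ∧ x 0 < 1 ∧ 0 < x 1 ∧ x 1 < 1}) :
    ∃ hsub : {x : Fin 2 → ℝ | 0 < x 0 ∧ x 0 < 1 ∧ 0 < x 1 ∧ x 1 < 1} ⊆ T.domain,
      KZ.of T - KZ.of (T.restrict _ shadowSq_isSemialgebraic_sq hsub) ∈ KZ.relations := by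
  have hsub : {x : Fin 2 → ℝ | 0 < x 0 ∧ x 0 < 1 ∧ 0 < x 1 ∧ x 1 < 1} ⊆ T.domain := by
    rw [hT]; rintro x ⟨h0, h1, h2, h3⟩; exact ⟨h0.le, h1, h2, h3⟩
  refine ⟨hsub, T.of_sub_of_restrict_mem_relations shadowSq_isSemialgebraic_sq hsub ?_⟩
  have hline : volume {x : Fin 2 → ℝ | x 0 = 0} = 0 := by
    rw [volume_pi]; exact Measure.pi_hyperplane _ 0 0
  refine measure_mono_null (fun x hx => ?_) hline
  rw [hT] at hx
  obtain ⟨⟨h0, h1, h2, h3⟩, hxE⟩ := hx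
  rcases h0.lt_or_eq with h | h
  · exact absurd ⟨h, h1, h2, h3⟩ hxE
  · exact h.symm

/-! ## The stub -/

/-- **STUB `stub_shadowSquare`** (rules 2, 1a, 1b; the planar half of `ShadowSquareTetra`): every flat-shadow
representation of `T(i)` — triangle `Δ(0,1,i)`, density `1/(2(q₀+q₁−q₀²−q₁²))`, written with `z = Complex.I`
literally so that the landed cusp descent `tetraFlatten` applies — is KZ-equivalent to every shadow-square
representation `[[0,1)×(0,1), 1/(2 − a(1+s²))]`, and one such exists: fan map from the rectangle `(0,1)×(−1,1)`,
null line `s = 0`, reflection `s ↦ −s`, doubling `f = h + h`, null edge `a = 0`.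
[cite: Milnor1982, Appendix, Lemma 2] -/
theorem stub_shadowSquare : ∀ F : Literature.NumberTheory.Transcendental.KZ.IntegralRep 2, F.domain = {q | 0 < q 1 ∧ Complex.I.re * q 1 < Complex.I.im * q 0 ∧ Complex.I.im * (q 0 - 1) < (Complex.I.re - 1) * q 1} → Set.EqOn F.integrand (fun q => Complex.I.im / (2 * (Complex.I.im * (q 0 - q 0 ^ 2 - q 1 ^ 2) + (Complex.normSq Complex.I - Complex.I.re) * q 1))) F.domain → (∃ T : Literature.NumberTheory.Transcendental.KZ.IntegralRep 2, T.domain = {x | 0 ≤ x 0 ∧ x 0 < 1 ∧ 0 < x 1 ∧ x 1 < 1} ∧ Set.EqOn T.integrand (fun x => 1 / (2 - x 0 * (1 + x 1 ^ 2))) T.domain) ∧ (∀ T : Literature.NumberTheory.Transcendental.KZ.IntegralRep 2, T.domain = {x | 0 ≤ x 0 ∧ x 0 < 1 ∧ 0 < x 1 ∧ x 1 < 1} → Set.EqOn T.integrand (fun x => 1 / (2 - x 0 * (1 + x 1 ^ 2))) T.domain → Literature.NumberTheory.Transcendental.KZ.Equivalent T F) := by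
  intro F hF hFi
  -- unfold the `z = i` literals
  have hF' : F.domain = {q : Fin 2 → ℝ | 0 < q 0 ∧ 0 < q 1 ∧ q 0 + q 1 < 1} := hF.trans flatTriangle_I_eq
  have hFi' : EqOn F.integrand (fun q => 1 / (2 * (q 0 - q 0 ^ 2 - q 1 ^ 2 + q 1))) F.domain :=
    fun q hq => (hFi hq).trans (flatDensity_I_eq q)
  -- step 1: the rectangle representation
  obtain ⟨Q, hQ, hQi, hQF⟩ := shadowSq_exists_rect F hF' hFi'
  refine ⟨shadowSq_exists_T Q hQ hQi, fun T hT hTi => ?_⟩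
  -- steps 2–5
  obtain ⟨hlo, hup, hsplit⟩ := shadowSq_split Q hQ
  have hrefl := shadowSq_reflect Q hQi hlo hup
  obtain ⟨hsubT, hedge⟩ := shadowSq_edge T hT
  have hdouble := shadowSq_double Q hQi hup (T.restrict _ shadowSq_isSemialgebraic_sq hsubT) rfl
    (fun x hx => hTi (hsubT hx))
  show KZ.of T - KZ.of F ∈ KZ.relations
  have key : KZ.of T - KZ.of F =
      (KZ.of T - KZ.of (T.restrict _ shadowSq_isSemialgebraic_sq hsubT)) +
      (KZ.of (T.restrict _ shadowSq_isSemialgebraic_sq hsubT) -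
        KZ.of (Q.restrict _ shadowSq_isSemialgebraic_sq hup) -
        KZ.of (Q.restrict _ shadowSq_isSemialgebraic_sq hup)) -
      (KZ.of (Q.restrict _ shadowSq_isSemialgebraic_lower hlo) -
        KZ.of (Q.restrict _ shadowSq_isSemialgebraic_sq hup)) -
      (KZ.of Q - KZ.of (Q.restrict _ shadowSq_isSemialgebraic_lower hlo) -
        KZ.of (Q.restrict _ shadowSq_isSemialgebraic_sq hup)) +
      (KZ.of Q - KZ.of F) := by
    abel
  rw [key]
  exact add_mem (sub_mem (sub_mem (add_mem hedge hdouble) hrefl) hsplit) hQF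

end Summit.KontsevichZagierPeriods.HyperbolicBloch.OffTetraSectorKernel

end
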